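import Summits.NavierStokesRegularity.NavierStokesRegularity.Theses.QuantisedSymmetry
import Summits.NavierStokesRegularity.NavierStokesRegularity.Theorems.QuantisedSymmetryPolyhedralTruncationBridge
import Summits.NavierStokesRegularity.NavierStokesRegularity.Theorems.QuantisedSymmetryPolyhedralDssProfileExistsDominatesBlowupProfile
import Summits.NavierStokesRegularity.NavierStokesRegularity.Theorems.QuantisedSymmetryPolyhedralDssProfileExistsCellOfProfile
import Literature.Analysis.FluidPDE.SelfSimilarLiouville
import HarnessLib

/-!
# Strategist sketch S19·g19 (independent census family `s`) for crux `PolyhedralDssProfileExists`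
# (X⁻, stmt-NavierStokesRegularity-1404) of route `QuantisedSymmetry` (negative side)

Kernel-checked exhibits behind `STRATEGY-CENSUS-s19.md` (no `sorry`; defs + routine logic only):

* §1 `summit_strength` — X⁻ ⇒ ¬ Clay (A) by LANDED theorems (the route's `closes`,
  `quantisedSymmetry_polyhedralTruncationBridge_proof`, `ClayUniqueness_holds`): the crux strictly dominates the
  negated summit; `drops_G` — X⁻ ⇒ the sector-free ∃-crux `Blowup.BlowupTypeIDssProfile` (stmt-0155): the point
  group `G` is load-bearing in no landed implication.
* §2 readable abbreviations (`IsPolyhedral`, `IsPolyProfile`, `IsGCell`) with `crux_iff` / `cell_iff` proving they are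
  letter-faithful to the route decl and to the registered stub `stub_polyhedralCellExists`.
* §3 STRENGTHEN — two typed strengthenings S⁺: `PolyhedralSsProfileExists` (continuous self-similarity; dead by
  Tsai 1998 = named fact `Literature.Analysis.FluidPDE.tsai_selfsimilar` once KNSS regularity puts the profile in Leray's class) and
  `LocallyUniquePolyProfileExists` (isolated modulo scaling); both ⇒ X⁻ (`ss_stronger`, `locallyUnique_stronger`).
* §4 DECOMPOSITION — the Newton–Kantorovich certificate split typed: (A) `ApproxCellExists δ` (a certified
  approximate `G`-cell with zoom residual `≤ δ/(1+‖x‖)`), (B) `NKBridge` (some residual level closes up), the abstract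
  Banach-space engine `NewtonKantorovich` (a theorem of analysis, stated), and the assembly `nk_assembly`; plus
  `approx_of_cell` (an exact cell is an approximate cell at every `δ ≥ 0`, so (A) is implied by X⁻ for each δ).
* §5 NEGATION — the only input the point group adds to the Liouville side beyond the landed `ℓ ≤ 2` moment
  identities (`stub_isotropicMoments`, `stub_firstMomentsVanish`): the invariant-harmonic gap `InvariantHarmonicGap G ℓ`
  (no non-constant `G`-invariant harmonic polynomial of degree `< ℓ`; ℓ_T = 3, ℓ_O = 4, ℓ_I = 6, Klein / Meyer 1954),
  typed over `MvPolynomial`; it sharpens small-constant thresholds only.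
-/

set_option linter.dupNamespace false
set_option autoImplicit false

namespace Summit.NavierStokesRegularity.NavierStokesRegularity.Cruxes.PolyhedralDssProfileExists.StrategistS19g19

open MeasureTheory Set Function
open Literature.Analysis.FluidPDE

/-- `ℝ³` as a Euclidean space (abbreviation local to this sketch). -/
abbrev E3 : Type := EuclideanSpace ℝ (Fin 3)

/-! ## §1 Summit strength: X⁻ strictly implies ¬S, and `G` is load-bearing nowhere -/

/-- **X⁻ ⇒ ¬ NavierStokesRegularity** from landed theorems only: the route's deciding theorem `closes` (same type as
the landed `Assembly` = `quantisedSymmetry_assembly_proof`), its truncation bridge (#4,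
`quantisedSymmetry_polyhedralTruncationBridge_proof`, an instance of `FilamentSkeletonRss.RdssProfileTruncation` at
`R = refl` in which the `G`-clauses are unused) and `ClayUniqueness_holds`. Hence the open crux is AT LEAST
summit-strength (for the negated summit). -/
theorem summit_strength
    (hX : _root_.Summit.NavierStokesRegularity.NavierStokesRegularity.Theses.QuantisedSymmetry.PolyhedralDssProfileExists) :
    ¬ _root_.NavierStokesRegularity :=
  _root_.Summit.NavierStokesRegularity.NavierStokesRegularity.Theses.QuantisedSymmetry.closes hX
    _root_.Summit.NavierStokesRegularity.NavierStokesRegularity.Theorems.quantisedSymmetry_polyhedralTruncationBridge_proof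
    _root_.Summit.NavierStokesRegularity.NavierStokesRegularity.Theses.QuantisedSymmetry.ClayUniqueness_holds

/-- **`G` drops out**: X⁻ ⇒ `Blowup.BlowupTypeIDssProfile` (stmt-NavierStokesRegularity-0155, the sector-free
"some Type-I (R)DSS profile exists"), the landed `stub_dominatesBlowupProfile` (lead c15). -/
theorem drops_G
    (hX : _root_.Summit.NavierStokesRegularity.NavierStokesRegularity.Theses.QuantisedSymmetry.PolyhedralDssProfileExists) :
    _root_.Summit.NavierStokesRegularity.NavierStokesRegularity.Theses.Blowup.BlowupTypeIDssProfile :=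
  _root_.Summit.NavierStokesRegularity.NavierStokesRegularity.Theorems.PolyhedralDssProfileExists.PolyhedralCell.stub_dominatesBlowupProfile
    hX

/-- X⁻ negates Tsai's Type-I `λ`-DSS Liouville statement (Bradshaw–Tsai 2017, Open Problem 5.1) at its own factor. -/
theorem negates_typeIDSSLiouville
    (hX : _root_.Summit.NavierStokesRegularity.NavierStokesRegularity.Theses.QuantisedSymmetry.PolyhedralDssProfileExists) :
    ∃ c : ℝ, 1 < c ∧ ¬ TypeIDSSLiouville c :=
  _root_.Summit.NavierStokesRegularity.NavierStokesRegularity.Theorems.PolyhedralDssProfileExists.PolyhedralCell.exists_not_typeIDSSLiouville_of_polyhedralDssProfileExists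
    hX

/-! ## §2 Letter-faithful abbreviations -/

/-- The point-group clauses of X⁻: `G` finite, proper rotations, no invariant line or plane (irreducible on `ℝ³`);
i.e. `G` is one of the rotation groups T, O, I. -/
def IsPolyhedral (G : Subgroup (E3 ≃ₗᵢ[ℝ] E3)) : Prop :=
  Finite G ∧ (∀ g ∈ G, LinearMap.det (g.toLinearEquiv : E3 →ₗ[ℝ] E3) = 1) ∧
    ∀ V : Submodule ℝ E3, (∀ g ∈ G, ∀ v ∈ V, g v ∈ V) → V = ⊥ ∨ V = ⊤

/-- The profile clauses of X⁻ at fixed `(G, λ)`: nontrivial `G`-equivariant Type-I `λ`-DSS ancient mild solution. -/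
def IsPolyProfile (G : Subgroup (E3 ≃ₗᵢ[ℝ] E3)) (c : ℝ) (u : ℝ → E3 → E3) : Prop :=
  IsAncientMildSolution 1 u ∧ (∀ t < 0, AEStronglyMeasurable (u t) volume) ∧ IsDiscretelySelfSimilar c u ∧
    (∃ C₀ : ℝ, HasTypeIDecay C₀ u) ∧ (∀ g ∈ G, ∀ t x, u t (g x) = g (u t x)) ∧ ¬ (∀ t < 0, u t =ᵐ[volume] 0)

/-- The `G`-cell clauses of the registered stub `stub_polyhedralCellExists` (line `polyhedral_cell`) at fixed
`(G, λ)`: a bounded continuous weakly solenoidal `G`-equivariant Oseen-mild field on the model period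
`[-1, -λ⁻²] × ℝ³` closing up under the zoom. -/
def IsGCell (G : Subgroup (E3 ≃ₗᵢ[ℝ] E3)) (c : ℝ) (v : ℝ → E3 → E3) : Prop :=
  ContinuousOn (uncurry v) (Icc (-1 : ℝ) (-(c ^ 2)⁻¹) ×ˢ univ) ∧
    (∃ M : ℝ, ∀ t ∈ Icc (-1 : ℝ) (-(c ^ 2)⁻¹), ∀ x, ‖v t x‖ ≤ M) ∧
    (∀ t ∈ Icc (-1 : ℝ) (-(c ^ 2)⁻¹), IsWeaklyDivFree (v t)) ∧
    (∀ s t : ℝ, -1 ≤ s → s < t → t ≤ -(c ^ 2)⁻¹ → ∀ x,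
      v t x = heatFlow (v s) (t - s) x - oseenDuhamel 1 s v v t x) ∧
    (∀ x, v (-(c ^ 2)⁻¹) x = c • v (-1) (c • x)) ∧
    (∀ g ∈ G, ∀ t ∈ Icc (-1 : ℝ) (-(c ^ 2)⁻¹), ∀ x, v t (g x) = g (v t x))

/-- ∃-form of the registered stub with the abbreviations. -/
def CellExists : Prop :=
  ∃ G : Subgroup (E3 ≃ₗᵢ[ℝ] E3), IsPolyhedral G ∧ ∃ c : ℝ, 1 < c ∧ ∃ v : ℝ → E3 → E3,
    IsGCell G c v ∧ MemLp (v (-1)) 4 volume ∧ ¬ (v (-1) =ᵐ[volume] 0)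

/-- The abbreviations are letter-faithful to the route decl (definitional unfolding). -/
theorem crux_iff :
    _root_.Summit.NavierStokesRegularity.NavierStokesRegularity.Theses.QuantisedSymmetry.PolyhedralDssProfileExists ↔
      ∃ G : Subgroup (E3 ≃ₗᵢ[ℝ] E3), IsPolyhedral G ∧ ∃ c : ℝ, 1 < c ∧ ∃ u : ℝ → E3 → E3, IsPolyProfile G c u := by
  unfold IsPolyhedral IsPolyProfile
    _root_.Summit.NavierStokesRegularity.NavierStokesRegularity.Theses.QuantisedSymmetry.PolyhedralDssProfileExists
  simp only [and_assoc]

/-- … and to the registered ∃-stub: `X⁻ ↔ CellExists` is the landed `polyhedralDssProfileExists_iff_cell` (lead c15),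
so the cell is a REFORMULATION of the crux, not a piece of it. -/
theorem cell_iff :
    _root_.Summit.NavierStokesRegularity.NavierStokesRegularity.Theses.QuantisedSymmetry.PolyhedralDssProfileExists ↔
      CellExists := by
  rw [_root_.Summit.NavierStokesRegularity.NavierStokesRegularity.Theorems.PolyhedralDssProfileExists.PolyhedralCell.polyhedralDssProfileExists_iff_cell]
  unfold CellExists IsPolyhedral IsGCell
  simp only [and_assoc]

/-! ## §3 STRENGTHEN — typed S⁺ and why the added rigidity buys nothing here -/

/-- **S⁺₁ (continuous self-similarity).** A nontrivial `G`-equivariant Type-I ancient mild solution which is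
self-similar for EVERY factor (a steady Leray profile `u = (-t)^{-1/2} U(x/√(-t))`). DEAD: Type-I decay gives
`|U(y)| ≤ C₀/(1+|y|) ∈ L⁴(ℝ³)`, KNSS 2009 regularity puts `U` in Leray's profile class, and Tsai 1998 Thm 1
(`Literature.Analysis.FluidPDE.tsai_selfsimilar`, `3 < q = 4 < ∞`) forces `U ≡ 0` — for every `G`. Recorded to show that the ONLY
room left for X⁻ is genuinely time-periodic (non-steady) dynamics in similarity variables. -/
def PolyhedralSsProfileExists : Prop :=
  ∃ G : Subgroup (E3 ≃ₗᵢ[ℝ] E3), IsPolyhedral G ∧ ∃ u : ℝ → E3 → E3,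
    IsAncientMildSolution 1 u ∧ (∀ t < 0, AEStronglyMeasurable (u t) volume) ∧ IsSelfSimilar u ∧
    (∃ C₀ : ℝ, HasTypeIDecay C₀ u) ∧ (∀ g ∈ G, ∀ t x, u t (g x) = g (u t x)) ∧ ¬ (∀ t < 0, u t =ᵐ[volume] 0)

/-- S⁺₁ ⇒ X⁻ (a self-similar field is `2`-DSS). -/
theorem ss_stronger (h : PolyhedralSsProfileExists) :
    _root_.Summit.NavierStokesRegularity.NavierStokesRegularity.Theses.QuantisedSymmetry.PolyhedralDssProfileExists := by
  obtain ⟨G, ⟨hfin, hdet, hirr⟩, u, hanc, hmeas, hss, hdec, heqv, hnt⟩ := h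
  exact ⟨G, hfin, hdet, hirr, 2, by norm_num, u, hanc, hmeas,
    hss.isDiscretelySelfSimilar (by norm_num : (0 : ℝ) < 2), hdec, heqv, hnt⟩

/-- **S⁺₂ (isolated modulo scaling).** X⁻ with a witness `(G, λ, u)` that is LOCALLY UNIQUE among `(G, λ)`-profiles
up to the parabolic rescaling `nsRescale μ`, in the scale-invariant Type-I norm: the rigidity a continuation /
Newton scheme would need as INPUT and can only produce as OUTPUT. Nothing in print decides even non-degeneracy of a
single backward DSS Navier–Stokes profile (none is known to exist: Pineau–Vicol 2026, §1.3), so the added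
structure gives no handle on THIS step. -/
def LocallyUniquePolyProfileExists : Prop :=
  ∃ G : Subgroup (E3 ≃ₗᵢ[ℝ] E3), IsPolyhedral G ∧ ∃ c : ℝ, 1 < c ∧ ∃ u : ℝ → E3 → E3, IsPolyProfile G c u ∧
    ∃ ε : ℝ, 0 < ε ∧ ∀ u' : ℝ → E3 → E3, IsPolyProfile G c u' →
      (∀ t < 0, ∀ x, ‖u' t x - u t x‖ ≤ ε / (‖x‖ + Real.sqrt (-t))) →
        ∃ μ : ℝ, 0 < μ ∧ u' = nsRescale μ u

/-- S⁺₂ ⇒ X⁻ (forget the isolation clause). -/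
theorem locallyUnique_stronger (h : LocallyUniquePolyProfileExists) :
    _root_.Summit.NavierStokesRegularity.NavierStokesRegularity.Theses.QuantisedSymmetry.PolyhedralDssProfileExists := by
  obtain ⟨G, hG, c, hc, u, hu, -⟩ := h
  exact crux_iff.mpr ⟨G, hG, c, hc, u, hu⟩

/-! ## §4 DECOMPOSITION — the Newton–Kantorovich certificate split, typed -/

/-- **(A) certified approximate `G`-cell at residual `δ`.** All cell clauses except exact zoom-periodicity, which is
replaced by the scale-covariant residual bound `‖v(-λ⁻², x) - λ v(-1, λx)‖ ≤ δ/(1+‖x‖)`; `L⁴` datum not a.e. zero.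
This is the half a computer-assisted proof would have to deliver (interval arithmetic on a Galerkin/EVENMAP
truncation); NO numerical candidate exists (octahedral Kida–Pelz DNS saturates viscously; Hormoz–Brenner 2012;
no backward DSS Navier–Stokes profile has ever been computed). -/
def ApproxCellExists (δ : ℝ) : Prop :=
  ∃ G : Subgroup (E3 ≃ₗᵢ[ℝ] E3), IsPolyhedral G ∧ ∃ c : ℝ, 1 < c ∧ ∃ v : ℝ → E3 → E3,
    ContinuousOn (uncurry v) (Icc (-1 : ℝ) (-(c ^ 2)⁻¹) ×ˢ univ) ∧
    (∃ M : ℝ, ∀ t ∈ Icc (-1 : ℝ) (-(c ^ 2)⁻¹), ∀ x, ‖v t x‖ ≤ M) ∧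
    (∀ t ∈ Icc (-1 : ℝ) (-(c ^ 2)⁻¹), IsWeaklyDivFree (v t)) ∧
    (∀ s t : ℝ, -1 ≤ s → s < t → t ≤ -(c ^ 2)⁻¹ → ∀ x,
      v t x = heatFlow (v s) (t - s) x - oseenDuhamel 1 s v v t x) ∧
    (∀ g ∈ G, ∀ t ∈ Icc (-1 : ℝ) (-(c ^ 2)⁻¹), ∀ x, v t (g x) = g (v t x)) ∧
    (∀ x, ‖v (-(c ^ 2)⁻¹) x - c • v (-1) (c • x)‖ ≤ δ / (1 + ‖x‖)) ∧
    MemLp (v (-1)) 4 volume ∧ ¬ (v (-1) =ᵐ[volume] 0)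

/-- **(B) the bridge at some residual level**: an approximate `G`-cell with small enough residual closes up to an
exact one. As typed (without the spectral certificate `‖(I - D𝓡_{G,λ}(v₀))⁻¹‖ ≤ κ` on the scaling-transversal
subspace, which needs a Banach-space realisation of the period map not in the tree) it is NOT credible on its own;
it records the SHAPE of the missing half. -/
def NKBridge : Prop :=
  ∃ δ : ℝ, 0 < δ ∧ (ApproxCellExists δ → CellExists)

/-- **The abstract engine (Newton–Kantorovich, Banach-space form)** — a THEOREM of analysis (Kantorovich 1948;
Zeidler, *Nonlinear Functional Analysis* I, Thm 5.A), stated: a `C¹` map with `L`-Lipschitz derivative on a ball,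
invertible derivative at the centre with `‖A‖ ≤ κ`, defect `‖F y₀‖ ≤ δ`, `2κ²Lδ < 1`, `2κδ ≤ r`, has a zero in the
ball. Provable from Mathlib's Banach fixed-point theorem; it is the easy, sector-agnostic part of the split. -/
def NewtonKantorovich : Prop :=
  ∀ (Y : Type) [NormedAddCommGroup Y] [NormedSpace ℝ Y] [CompleteSpace Y]
    (F : Y → Y) (F' : Y → Y →L[ℝ] Y) (A : Y →L[ℝ] Y) (y₀ : Y) (r κ L δ : ℝ),
    0 < r → (∀ y ∈ Metric.closedBall y₀ r, HasFDerivAt F (F' y) y) →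
    (∀ y ∈ Metric.closedBall y₀ r, ∀ z ∈ Metric.closedBall y₀ r, ‖F' y - F' z‖ ≤ L * ‖y - z‖) →
    A.comp (F' y₀) = ContinuousLinearMap.id ℝ Y → (F' y₀).comp A = ContinuousLinearMap.id ℝ Y → ‖A‖ ≤ κ →
    ‖F y₀‖ ≤ δ → 2 * κ ^ 2 * L * δ < 1 → 2 * κ * δ ≤ r →
    ∃ y ∈ Metric.closedBall y₀ r, F y = 0

/-- An exact cell is an approximate cell at every residual `δ ≥ 0`: (A) is a CONSEQUENCE of X⁻ for each fixed δ
(so (A) alone never gives X⁻ or ¬S cheaply — it is strictly on the ∃-side and strictly weaker per δ). -/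
theorem approx_of_cell (h : CellExists) {δ : ℝ} (hδ : 0 ≤ δ) : ApproxCellExists δ := by
  obtain ⟨G, hG, c, hc, v, ⟨hcont, hbd, hdiv, hmild, hzoom, heqv⟩, hL4, hnt⟩ := h
  refine ⟨G, hG, c, hc, v, hcont, hbd, hdiv, hmild, heqv, ?_, hL4, hnt⟩
  intro x
  rw [hzoom x, sub_self, norm_zero]
  positivity

/-- **Assembly of the split** (pure logic + the landed `cell ⇒ X⁻`): (A) at every residual level and (B) give X⁻. -/
theorem nk_assembly (hA : ∀ δ : ℝ, 0 < δ → ApproxCellExists δ) (hB : NKBridge) :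
    _root_.Summit.NavierStokesRegularity.NavierStokesRegularity.Theses.QuantisedSymmetry.PolyhedralDssProfileExists := by
  obtain ⟨δ, hδ, hbridge⟩ := hB
  exact cell_iff.mpr (hbridge (hA δ hδ))

/-! ## §5 NEGATION — what the point group adds on the Liouville side -/

/-- The polynomial Laplacian on `ℝ[x₀, x₁, x₂]`. -/
noncomputable def polyLaplacian (p : MvPolynomial (Fin 3) ℝ) : MvPolynomial (Fin 3) ℝ :=
  ∑ i : Fin 3, MvPolynomial.pderiv i (MvPolynomial.pderiv i p)

/-- **Invariant-harmonic gap `ℓ`** of a point group `G`: every `G`-invariant harmonic homogeneous polynomial of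
degree `n`, `1 ≤ n < ℓ`, vanishes. Classical invariant theory (Klein 1884; B. Meyer, *Canad. J. Math.* 6 (1954)
135–157, Table p. 139): ℓ = 3 for every irreducible `G` (degrees 1, 2 are killed by irreducibility — these are the
landed `stub_firstMomentsVanish` / `stub_isotropicMoments`), ℓ_O = 4, ℓ_T = 3 (the cubic `x₀x₁x₂` is T-invariant),
ℓ_I = 6. Consequence for a `G`-equivariant profile: the radial flux `y·U(y)` and every invariant scalar built
from `U` have no angular modes `1 ≤ n < ℓ_G`, an angular Poincaré gain `1/(ℓ_G(ℓ_G+1))` on the non-radial part —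
it raises the small-`C₀` Liouville thresholds (Chae–Wolf `λ_*(C_*)`, KNSS small data) by a `G`-dependent factor and
is not coercive for large `C₀`: a lemma for the kill switch #3, not a disproof of X⁻. -/
def InvariantHarmonicGap (G : Subgroup (E3 ≃ₗᵢ[ℝ] E3)) (ℓ : ℕ) : Prop :=
  ∀ n : ℕ, 1 ≤ n → n < ℓ → ∀ p : MvPolynomial (Fin 3) ℝ, p.IsHomogeneous n → polyLaplacian p = 0 →
    (∀ g ∈ G, ∀ x : E3, MvPolynomial.eval (fun i => (g x) i) p = MvPolynomial.eval (fun i => x i) p) → p = 0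

/-- The typed claim behind §5 (invariant theory of the rotation groups; NOT proved here): every polyhedral `G` has
gap `3`, the octahedral group gap `4`, the icosahedral group gap `6`. Stated as the `G`-uniform part only. -/
def PolyhedralGapThree : Prop :=
  ∀ G : Subgroup (E3 ≃ₗᵢ[ℝ] E3), IsPolyhedral G → InvariantHarmonicGap G 3

end Summit.NavierStokesRegularity.NavierStokesRegularity.Cruxes.PolyhedralDssProfileExists.StrategistS19g19
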